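import Mathlib
import Literature.MathematicalPhysics.MHD.MercierNearAxis
import HarnessLib

/-!
# Bateman's near-axis equilibrium relation (7.3.5) FOLLOWS from the Grad–Shafranov jets at the magnetic axis
# (profiles with `FF′ = 0`; proved, pure algebra)

`MercierNearAxis.lean` (gridfusion-lit-3) types Bateman, *MHD Instabilities* (1978) §7.3: the near-axis volume
expansion (7.3.3) `V = 2π²(R_a − 2S(R − R_a))[e(R − R_a)² + y²/e + 2Δ(R − R_a)y²]`, `S = d/6 − 1/2` (7.3.4), and the
relation (7.3.5) `Δ = 1/(2e) − Q(e + 1/e) + (d/2)(e + 1/(3e))` (`triangularity e Q d`) which Bateman states as an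
EQUILIBRIUM RELATION the near-axis parameters must satisfy [bib `Bateman1978`].  The LADDER-GRIDFUSION cell reads the
parameters off the cubic axis jet of an up–down symmetric flux function `ψ` with axis `(R_a, 0)`
(`Summits/Ventures/FusionMHD/Models/SolovevPCFMercierAxis.lean`, dictionary of pub/gridfusion/models/MODEL-5-NOTES.md §6):
`e² = ψ_RR/ψ_ZZ`, `S = −R_aψ_RRR/(6ψ_RR)`, `d = 6S + 3`, jet-triangularity `Δ_jet = R_aψ_RZZ/(2eψ_ZZ) + S/e`.

THIS FILE proves that, for Solov'ev-type profiles WITHOUT poloidal current (`FF′ = 0`, i.e. `A = 0`, hence Bateman's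
current ratio `Q = 0`) the relation (7.3.5) is AUTOMATIC: it is exactly the third-order content of the Grad–Shafranov
equation at the axis.  Writing `a = ψ_RR`, `b = ψ_ZZ`, `t = ψ_RRR`, `u = ψ_RZZ` at `(R_a, 0)`:
* the GS equation `ψ_RR − ψ_R/R + ψ_ZZ = C R²` AT the axis (`ψ_R = 0`) reads `a + b = C R_a²`;
* its `R`-derivative `ψ_RRR − ψ_RR/R + ψ_R/R² + ψ_RZZ = 2CR` at the axis reads `t − a/R_a + u = 2C R_a`;
and from these two identities alone `Δ_jet = triangularity e 0 d` (`jetTriangularity_eq_triangularity`).  Consequences: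
the PCF identity `nearAxisTriangularity = triangularity e 0 0` of `SolovevPCFMercierAxis` (there proved by direct
computation) and the Cerfon–Freidberg ITER-like instance's «(7.3.5) residual ∋ 0» (bench/F2-CF-ITER-truth-lineage1.json row
B2, VALIDATED) are instances of one theorem; and lit-3's identification of Bateman (7.3.2) with Freidberg (12.89)
(`bound_one_eq_shapedBound`, p504651: `δ/ε = e·Δ(e, Q, d)`) may take `Δ` from the jets.
HONEST FRAMING: algebra about the MODELLED near-axis dictionary; no stability statement; the `Q ≠ 0` (poloidal-current)
member of (7.3.5) is not treated here.  Typer/prover: gridfusion-model-5 (g5), 2026-08-27.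
-/

noncomputable section

namespace Literature.MathematicalPhysics.MHD.Mercier.NearAxis

/-- From the `R`-derivative of the Grad–Shafranov equation at the axis: `R_a·ψ_RZZ = 3ψ_RR + 2ψ_ZZ − R_a·ψ_RRR`
(`A = 0` profiles). [cite: Bateman1978, §7.3 eq. (7.3.5)] -/
theorem axis_mixedJet_eq {a b t u R C : ℝ} (hR : R ≠ 0) (hGS : a + b = C * R ^ 2)
    (hGS' : t - a / R + u = 2 * C * R) : R * u = 3 * a + 2 * b - R * t := by
  have h1 : R * (t - a / R + u) = R * t - a + R * u := by field_simp
  have h2 : R * (t - a / R + u) = 2 * C * R ^ 2 := by rw [hGS']; ring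
  linarith

/-- **Bateman's (7.3.5) at `Q = 0` from the Grad–Shafranov jets.**  If `e² = a/b`, `a + b = C R²` (GS at the axis) and
`t − a/R + u = 2CR` (its `R`-derivative at the axis), then the jet-triangularity equals Bateman's
`triangularity e 0 d` with `d = 6S + 3`, `S = −Rt/(6a)`:
`R u/(2 e b) + S/e = 1/(2e) + (d/2)(e + 1/(3e))`. [cite: Bateman1978, §7.3 eq. (7.3.5)] -/
theorem jetTriangularity_eq_triangularity {a b t u R C e : ℝ} (ha : a ≠ 0) (hb : b ≠ 0) (hR : R ≠ 0) (he : e ≠ 0)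
    (hE : e ^ 2 = a / b) (hGS : a + b = C * R ^ 2) (hGS' : t - a / R + u = 2 * C * R) :
    R * u / (2 * e * b) + (-(R * t) / (6 * a)) / e = triangularity e 0 (6 * (-(R * t) / (6 * a)) + 3) := by
  have hu := axis_mixedJet_eq hR hGS hGS'
  have hab : a = e ^ 2 * b := by rw [hE]; field_simp
  unfold triangularity
  rw [div_add_div _ _ (by positivity) he, div_eq_iff (by positivity)]
  rw [hu]
  field_simp
  rw [hab]
  ring

/-- The same with the jet-triangularity written as ONE fraction of the jets: `Δ_jet = (R u·3a − R t·b)/(6 a e b)`.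
[cite: Bateman1978, §7.3 eq. (7.3.5)] -/
theorem jetTriangularity_eq (a b t u R e : ℝ) (ha : a ≠ 0) (hb : b ≠ 0) (he : e ≠ 0) :
    R * u / (2 * e * b) + (-(R * t) / (6 * a)) / e = (3 * a * (R * u) - b * (R * t)) / (6 * a * e * b) := by
  field_simp
  ring

/-- Conversely the relation DETERMINES the mixed jet: under `e² = a/b` and GS at the axis, (7.3.5) at `Q = 0` holds
iff `R u = 3a + 2b − R t` (so a VALIDATED «(7.3.5) residual» is a check of `ψ_RZZ` against the GS equation).
[cite: Bateman1978, §7.3 eq. (7.3.5)] -/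
theorem triangularity_iff_mixedJet {a b t u R e : ℝ} (ha : a ≠ 0) (hb : b ≠ 0) (he : 0 < e)
    (hE : e ^ 2 = a / b) :
    R * u / (2 * e * b) + (-(R * t) / (6 * a)) / e = triangularity e 0 (6 * (-(R * t) / (6 * a)) + 3)
      ↔ R * u = 3 * a + 2 * b - R * t := by
  have hab : a = e ^ 2 * b := by rw [hE]; field_simp
  unfold triangularity
  constructor
  · intro h
    rw [div_add_div _ _ (by positivity) he.ne', div_eq_iff (by positivity)] at h
    field_simp at h
    rw [hab] at h ⊢
    -- `h` is now a polynomial identity; solve the (linear in `u`) equation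
    have hb2 : b ^ 2 ≠ 0 := pow_ne_zero 2 hb
    have he2 : e ^ 2 ≠ 0 := pow_ne_zero 2 he.ne'
    apply mul_left_cancel₀ (mul_ne_zero (mul_ne_zero hb hb) (mul_ne_zero he2 he.ne'))
    linear_combination (b * e / 18) * h
  · intro hu
    rw [div_add_div _ _ (by positivity) he.ne', div_eq_iff (by positivity), hu]
    field_simp
    rw [hab]
    ring

end Literature.MathematicalPhysics.MHD.Mercier.NearAxis
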